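import Mathlib
import Summits.ValiantsHypothesis.ValiantsHypothesis.Theorems.FifoMatchingNNLinearDegreeCofactorHardShedWordContent
import Summits.ValiantsHypothesis.ValiantsHypothesis.Theorems.FifoMatchingNNLinearDegreeCofactorHardAdaptedWalk
import HarnessLib

/-!
# Crux `NNLinearDegreeCofactorHard` (stmt-ValiantsHypothesis-23918), line `internal_cofactor`, stub S2b (ii):
# the shed queue word — the BAND and the fair-rank REGULARITY are cheap (design memo §1: `#BB ≥ 2^N/poly`)

The fair walk of `shedWord R H E y` (`…ShedWordContent.fairWalk`) is an ADAPTED `±1` walk on the cube in the sense of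
`…AdaptedWalk`: whether position `s` is fair depends only on the bits `< s`.  Hence the Azuma–Hoeffding counts apply:

* `shedPrefix_flipAt`, `adapted_isFair` — flipping a bit at a coordinate `≥ s` does not change the prefix of length `s`,
  so «`s` is fair» is adapted; `walk_isFair_eq_fairWalk` — the generic walk is the fair walk;
* `card_filter_fairWalk_ge_le` / `…_le_neg_le` — `#{y : a ≤ ±fairWalk t} ≤ exp(−a²/(2N))·2^N`;
  `card_filter_exists_abs_fairWalk_ge_le` — **band**: the bit strings whose fair walk leaves `(−a, a)` at some time
  `t ≤ T` number at most `2(T+1)·exp(−a²/(2N))·2^N` (with `a = H/4`, `H = N^{2/3}`: a stretched-exponentially small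
  fraction; by `sContent_eq_of_walk_gt` the others keep S-content in `freeCount R 0 H ± a` and a non-empty queue);
* `fairRank`, `adapted_window`, `nAct_window_le` — «fair with fair-rank in `[i, i+f)`» is adapted and active at most `f`
  times; `card_filter_abs_windowWalk_ge_le` — **regularity**: `#{y : a ≤ |W_{i,f}(y)|} ≤ 2·exp(−a²/(2f))·2^N`, where
  `W_{i,f}` = (fair pushes) − (fair pops) among the fair positions of fair-rank in `[i, i+f)` (every S-block's flush
  reads such a window; this prices the successor surplus of the transfer-cost lemma (D*)).

Honest framing: counting; nothing here proves (D*), S2b, the crux or VP ≠ VNP (not proved). [folklore]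
-/

noncomputable section

-- Sub = Summit single-conjunct layout: the duplicated namespace component is mandated by the tree.
set_option linter.dupNamespace false

namespace Summit.ValiantsHypothesis.ValiantsHypothesis.Theorems.FifoMatching.NNLinearDegreeCofactorHard.ShedWord

open Finset Real
open Summit.ValiantsHypothesis.ValiantsHypothesis.Theorems.FifoMatching.NNLinearDegreeCofactorHard.AdaptedWalk

variable {N : ℕ} (R : Finset (Fin N)) (H E : ℕ)

/-! ### Adaptedness of the shed word -/

/-- The bit of `…ShedWordDefs` is the cube bit of `…AdaptedWalk`. [folklore] -/
theorem bit_eq_cbit (y : Fin N → Bool) (s : ℕ) : bit y s = cbit y s := rfl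

/-- **Flipping a bit at coordinate `t ≥ s` does not change the prefix of length `s`.** [folklore] -/
theorem shedPrefix_flipAt (t : Fin N) (y : Fin N → Bool) {s : ℕ} (hs : s ≤ t.val) :
    shedPrefix R H E (flipAt t y) s = shedPrefix R H E y s := by
  induction s with
  | zero => rfl
  | succ s ih =>
    rw [shedPrefix_succ, shedPrefix_succ, ih (Nat.le_of_succ_le hs)]
    congr 2
    unfold shedLetter
    rw [ih (Nat.le_of_succ_le hs), bit_eq_cbit, bit_eq_cbit, cbit_flipAt_of_lt t y (Nat.lt_of_succ_le hs)]

/-- Fairness of position `s` is unchanged by flipping a bit at a coordinate `≥ s`. [folklore] -/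
theorem isFair_flipAt (t : Fin N) (y : Fin N → Bool) {s : ℕ} (hs : s ≤ t.val) :
    isFair R H E (flipAt t y) s = isFair R H E y s := by
  unfold isFair; rw [shedPrefix_flipAt R H E t y hs]

/-- «Position `s` is fair» is an adapted activity predicate. [folklore] -/
theorem adapted_isFair : Adapted (fun s (y : Fin N → Bool) => isFair R H E y s) :=
  fun _ t y hs => isFair_flipAt R H E t y hs

/-- The generic adapted walk with activity «fair» is the fair walk. [folklore] -/
theorem walk_isFair_eq_fairWalk (t : ℕ) (y : Fin N → Bool) :
    walk (fun s (y : Fin N → Bool) => isFair R H E y s) t y = (fairWalk R H E y t : ℝ) := by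
  unfold walk fairWalk step
  rw [Int.cast_sum]
  refine sum_congr rfl fun s _ => ?_
  simp only [← bit_eq_cbit]
  split_ifs <;> simp

/-- The number of fair positions before `t` is at most `t`. [folklore] -/
theorem nAct_isFair_le (t : ℕ) (y : Fin N → Bool) : nAct (fun s (y : Fin N → Bool) => isFair R H E y s) t y ≤ t := by
  unfold nAct
  exact (card_filter_le _ _).trans (by simp)

/-! ### The band -/

/-- **Upper tail of the fair walk**: `#{y : a ≤ fairWalk t} ≤ exp(−a²/(2N))·2^N` (`t ≤ N`, `0 < N`, `0 ≤ a`). [folklore] -/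
theorem card_filter_fairWalk_ge_le (hN : 0 < N) {t : ℕ} (ht : t ≤ N) {a : ℝ} (ha : 0 ≤ a) :
    (((univ : Finset (Fin N → Bool)).filter fun y => a ≤ (fairWalk R H E y t : ℝ)).card : ℝ) ≤
      Real.exp (-(a ^ 2 / (2 * N))) * 2 ^ N := by
  have h := card_filter_walk_ge_le (adapted_isFair R H E) ht hN (fun y => (nAct_isFair_le R H E t y).trans ht) ha
  simpa only [walk_isFair_eq_fairWalk] using h

/-- **Lower tail of the fair walk.** [folklore] -/
theorem card_filter_fairWalk_le_neg_le (hN : 0 < N) {t : ℕ} (ht : t ≤ N) {a : ℝ} (ha : 0 ≤ a) :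
    (((univ : Finset (Fin N → Bool)).filter fun y => (fairWalk R H E y t : ℝ) ≤ -a).card : ℝ) ≤
      Real.exp (-(a ^ 2 / (2 * N))) * 2 ^ N := by
  have h := card_filter_walk_le_neg_le (adapted_isFair R H E) ht hN (fun y => (nAct_isFair_le R H E t y).trans ht) ha
  simpa only [walk_isFair_eq_fairWalk] using h

/-- **The band is cheap**: the bit strings whose fair walk reaches `|·| ≥ a` at some time `t ≤ T` (`T ≤ N`) number at
most `2(T+1)·exp(−a²/(2N))·2^N`. [folklore] -/
theorem card_filter_exists_abs_fairWalk_ge_le (hN : 0 < N) {T : ℕ} (hT : T ≤ N) {a : ℝ} (ha : 0 ≤ a) :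
    (((univ : Finset (Fin N → Bool)).filter fun y => ∃ t, t ≤ T ∧ a ≤ |(fairWalk R H E y t : ℝ)|).card : ℝ) ≤
      2 * (T + 1) * Real.exp (-(a ^ 2 / (2 * N))) * 2 ^ N := by
  classical
  have hsub : ((univ : Finset (Fin N → Bool)).filter fun y => ∃ t, t ≤ T ∧ a ≤ |(fairWalk R H E y t : ℝ)|) ⊆
      (range (T + 1)).biUnion fun t =>
        ((univ : Finset (Fin N → Bool)).filter fun y => a ≤ (fairWalk R H E y t : ℝ)) ∪
          ((univ : Finset (Fin N → Bool)).filter fun y => (fairWalk R H E y t : ℝ) ≤ -a) := by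
    intro y hy
    obtain ⟨t, htT, hta⟩ := (mem_filter.1 hy).2
    rw [mem_biUnion]
    refine ⟨t, mem_range.2 (Nat.lt_succ_of_le htT), ?_⟩
    rw [mem_union, mem_filter, mem_filter]
    rcases le_abs'.1 hta with h | h
    · exact Or.inr ⟨mem_univ _, h⟩
    · exact Or.inl ⟨mem_univ _, h⟩
  calc (((univ : Finset (Fin N → Bool)).filter fun y => ∃ t, t ≤ T ∧ a ≤ |(fairWalk R H E y t : ℝ)|).card : ℝ)
      ≤ ((range (T + 1)).biUnion fun t =>
          ((univ : Finset (Fin N → Bool)).filter fun y => a ≤ (fairWalk R H E y t : ℝ)) ∪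
            ((univ : Finset (Fin N → Bool)).filter fun y => (fairWalk R H E y t : ℝ) ≤ -a)).card := by
        exact_mod_cast card_le_card hsub
    _ ≤ ∑ t ∈ range (T + 1), ((((univ : Finset (Fin N → Bool)).filter fun y => a ≤ (fairWalk R H E y t : ℝ)) ∪
            ((univ : Finset (Fin N → Bool)).filter fun y => (fairWalk R H E y t : ℝ) ≤ -a)).card : ℝ) := by
        exact_mod_cast card_biUnion_le
    _ ≤ ∑ t ∈ range (T + 1), (2 * Real.exp (-(a ^ 2 / (2 * N))) * 2 ^ N) := by
        refine sum_le_sum fun t ht => ?_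
        have htN : t ≤ N := (Nat.le_of_lt_succ (mem_range.1 ht)).trans hT
        calc (((((univ : Finset (Fin N → Bool)).filter fun y => a ≤ (fairWalk R H E y t : ℝ)) ∪
              ((univ : Finset (Fin N → Bool)).filter fun y => (fairWalk R H E y t : ℝ) ≤ -a)).card : ℕ) : ℝ)
            ≤ ((((univ : Finset (Fin N → Bool)).filter fun y => a ≤ (fairWalk R H E y t : ℝ)).card : ℝ) +
                (((univ : Finset (Fin N → Bool)).filter fun y => (fairWalk R H E y t : ℝ) ≤ -a).card : ℝ)) := by
              exact_mod_cast card_union_le _ _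
          _ ≤ Real.exp (-(a ^ 2 / (2 * N))) * 2 ^ N + Real.exp (-(a ^ 2 / (2 * N))) * 2 ^ N :=
              add_le_add (card_filter_fairWalk_ge_le R H E hN htN ha) (card_filter_fairWalk_le_neg_le R H E hN htN ha)
          _ = 2 * Real.exp (-(a ^ 2 / (2 * N))) * 2 ^ N := by ring
    _ = 2 * (T + 1) * Real.exp (-(a ^ 2 / (2 * N))) * 2 ^ N := by
        rw [sum_const, card_range, nsmul_eq_mul]; push_cast; ring

/-! ### Fair-rank windows (regularity) -/

/-- The FAIR RANK of position `s`: the number of fair positions before `s`. [folklore] -/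
def fairRank (y : Fin N → Bool) (s : ℕ) : ℕ := nAct (fun u (y : Fin N → Bool) => isFair R H E y u) s y

/-- The activity «fair, with fair rank in `[i, i + f)`». [folklore] -/
def windowAct (i f : ℕ) (s : ℕ) (y : Fin N → Bool) : Bool :=
  isFair R H E y s && decide (i ≤ fairRank R H E y s) && decide (fairRank R H E y s < i + f)

/-- The WINDOW WALK: (fair pushes) − (fair pops) over the fair positions of fair rank in `[i, i + f)`. [folklore] -/
def windowWalk (i f : ℕ) (y : Fin N → Bool) : ℝ := walk (windowAct R H E i f) N y

/-- The fair rank is unchanged by flipping a bit at a coordinate `≥ s`. [folklore] -/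
theorem fairRank_flipAt (t : Fin N) (y : Fin N → Bool) {s : ℕ} (hs : s ≤ t.val) :
    fairRank R H E (flipAt t y) s = fairRank R H E y s := by
  unfold fairRank nAct
  congr 1
  refine filter_congr fun u hu => ?_
  simp only [isFair_flipAt R H E t y ((le_of_lt (mem_range.1 hu)).trans hs)]

/-- The window activity is adapted. [folklore] -/
theorem adapted_window (i f : ℕ) : Adapted (windowAct R H E i f) := by
  intro s t y hs
  unfold windowAct
  rw [isFair_flipAt R H E t y hs, fairRank_flipAt R H E t y hs]

/-- The fair rank strictly increases along fair positions. [folklore] -/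
theorem fairRank_lt_of_lt (y : Fin N → Bool) {s s' : ℕ} (hss' : s < s') (hs : isFair R H E y s = true) :
    fairRank R H E y s < fairRank R H E y s' := by
  unfold fairRank nAct
  apply card_lt_card
  refine ⟨fun u hu => ?_, fun hsub => ?_⟩
  · rw [mem_filter, mem_range] at hu ⊢
    exact ⟨lt_trans hu.1 hss', hu.2⟩
  · have : s ∈ (range s).filter fun u => isFair R H E y u = true :=
      hsub (mem_filter.2 ⟨mem_range.2 hss', hs⟩)
    exact absurd (mem_range.1 (mem_filter.1 this).1) (lt_irrefl s)

/-- **A window of `f` fair ranks is active at most `f` times.** [folklore] -/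
theorem nAct_window_le (i f t : ℕ) (y : Fin N → Bool) : nAct (windowAct R H E i f) t y ≤ f := by
  classical
  unfold nAct
  set A := (range t).filter fun s => windowAct R H E i f s y = true with hA
  have hinj : Set.InjOn (fairRank R H E y) A := by
    intro s hs s' hs' heq
    by_contra hne
    have hsf : isFair R H E y s = true := by
      have := (mem_filter.1 hs).2; simp only [windowAct, Bool.and_eq_true] at this; exact this.1.1
    have hsf' : isFair R H E y s' = true := by
      have := (mem_filter.1 hs').2; simp only [windowAct, Bool.and_eq_true] at this; exact this.1.1
    rcases Nat.lt_or_gt_of_ne hne with h | h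
    · exact absurd heq (ne_of_lt (fairRank_lt_of_lt R H E y h hsf))
    · exact absurd heq (ne_of_gt (fairRank_lt_of_lt R H E y h hsf'))
  have himg : A.image (fairRank R H E y) ⊆ Ico i (i + f) := by
    intro r hr
    obtain ⟨s, hs, rfl⟩ := mem_image.1 hr
    have := (mem_filter.1 hs).2
    simp only [windowAct, Bool.and_eq_true, decide_eq_true_eq] at this
    exact mem_Ico.2 ⟨this.1.2, this.2⟩
  calc A.card = (A.image (fairRank R H E y)).card := (card_image_of_injOn hinj).symm
    _ ≤ (Ico i (i + f)).card := card_le_card himg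
    _ = f := by simp

/-- **Regularity is cheap**: `#{y : a ≤ |W_{i,f}(y)|} ≤ 2·exp(−a²/(2f))·2^N` (`0 < f`, `0 ≤ a`). [folklore] -/
theorem card_filter_abs_windowWalk_ge_le (i : ℕ) {f : ℕ} (hf : 0 < f) {a : ℝ} (ha : 0 ≤ a) :
    (((univ : Finset (Fin N → Bool)).filter fun y => a ≤ |windowWalk R H E i f y|).card : ℝ) ≤
      2 * Real.exp (-(a ^ 2 / (2 * f))) * 2 ^ N := by
  classical
  have h1 := card_filter_walk_ge_le (adapted_window R H E i f) (le_refl N) hf (fun y => nAct_window_le R H E i f N y) ha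
  have h2 := card_filter_walk_le_neg_le (adapted_window R H E i f) (le_refl N) hf
    (fun y => nAct_window_le R H E i f N y) ha
  have hsub : ((univ : Finset (Fin N → Bool)).filter fun y => a ≤ |windowWalk R H E i f y|) ⊆
      ((univ : Finset (Fin N → Bool)).filter fun y => a ≤ walk (windowAct R H E i f) N y) ∪
        ((univ : Finset (Fin N → Bool)).filter fun y => walk (windowAct R H E i f) N y ≤ -a) := by
    intro y hy
    have hta := (mem_filter.1 hy).2
    rw [mem_union, mem_filter, mem_filter]
    unfold windowWalk at hta
    rcases le_abs'.1 hta with h | h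
    · exact Or.inr ⟨mem_univ _, h⟩
    · exact Or.inl ⟨mem_univ _, h⟩
  calc (((univ : Finset (Fin N → Bool)).filter fun y => a ≤ |windowWalk R H E i f y|).card : ℝ)
      ≤ ((((univ : Finset (Fin N → Bool)).filter fun y => a ≤ walk (windowAct R H E i f) N y) ∪
          ((univ : Finset (Fin N → Bool)).filter fun y => walk (windowAct R H E i f) N y ≤ -a)).card : ℝ) := by
        exact_mod_cast card_le_card hsub
    _ ≤ ((((univ : Finset (Fin N → Bool)).filter fun y => a ≤ walk (windowAct R H E i f) N y).card : ℝ) +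
          (((univ : Finset (Fin N → Bool)).filter fun y => walk (windowAct R H E i f) N y ≤ -a).card : ℝ)) := by
        exact_mod_cast card_union_le _ _
    _ ≤ Real.exp (-(a ^ 2 / (2 * f))) * 2 ^ N + Real.exp (-(a ^ 2 / (2 * f))) * 2 ^ N := add_le_add h1 h2
    _ = 2 * Real.exp (-(a ^ 2 / (2 * f))) * 2 ^ N := by ring

end Summit.ValiantsHypothesis.ValiantsHypothesis.Theorems.FifoMatching.NNLinearDegreeCofactorHard.ShedWord
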